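import Summits.CriticalPhenomena.PercolationContinuityZ3.Theorems.Transplant.SkelPhiCellsConcG
import HarnessLib

/-!
# L3′ (part 3): the cell geometry of record at φ-LEVEL over the two-unit cells, companion file — `ExitGeom`, `StepsGeom`, `LevelGeom`
# (with the STAIRCASE levels) and `QSepGeom` for `Skelφ.cellGeomSG` (re-cut of `SkelCellsConcGLevels`; DPRIME-SCOPE §2 L3′, p3 addendum K)

builds on p205010 (kernel theorem, internal audit signed; external expert review pending) — nothing in this file uses p205010.
Lane `prim-bschramm-*`, seat `prim-bschramm-p2` (gen 7); helper file (`--supports stmt-CriticalPhenomena-4575`).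

Companion of `SkelPhiCellsConcG` (400-line rule).  Source `SkelCellsConcGLevels` (p2 gen 3) over `Φ : PlanarSkeletonConc G` and one-unit cells;
here `φ : V → Site 2` with `hlip : Skelφ.Lip G φ` / `hstep : Skelφ.Steps G φ` explicit, hp-8's two-unit `P : PCells2`, and the level record
`Skelφ.levelDataS φ P` whose `lev` is the planar level composed with the staircase `PCells2.stairLev P δ.1` (`L j = 2j`, `ℓQ = 1`).  The only
non-verbatim port is `LevelGeom`: each clause is the source's planar argument followed by one reading lemma of `PlanarCells2StairLev`
(`stairLev_le_add_one` for `adj_le`, `stairLev_le_one_of_le` for `lev_Q/lev_Hfull`, `le_faceRow_of_stairLev_le` / `eq_faceRow_of_stairLev_eq`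
for `mem_Stub/mem_Face`, `stairLev_faceRow` / `stairLev_ge_of_face_le` for `Face_far/M_far`).
* `exitGeomSG (hlip)` (`locFin`: a `G`-neighbour inside `E_{w,δ}` pins `w + δ` within `35 r_i + 1` of `φ y` coordinatewise);
* `stepsGeomSG (hstep)`;
* `lev_le_lev_add_one_of_adj (hlip)`, `mem_VStair_Stub_of_adj (hlip)`, `mem_VWin_EfarN_of_adj (hlip)`, **`levelGeomSG (hlip)`**; `qSepGeomSG (hlip)`.
[cite: KozmaNitzan2024, §4 pp. 25–27, 30–31 (Q_v, M_v, E_{v,x}, H^j_{v,x}, F^j_{v,x}; Step IV)] [cite: GrimmettPercolation1999, §7.2]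
-/

noncomputable section

open scoped Classical

namespace Summit.CriticalPhenomena.PercolationContinuityZ3.Theorems

namespace Transplant

namespace Skelφ

open Literature.Probability.Percolation Literature.Probability.LatticeModels SimpleGraph KNCells
open Literature.Probability.Percolation.KozmaNitzan.Cells (oth oth_ne sgOf sgOf_sign stepVec_apply_fst stepVec_apply_oth eq_oth_of_ne oth_oth)
open Literature.Barriers.CriticalPhenomena (graphBall graphBall_finite mem_graphBall_self graphBall_mono)
open BoxProdZ2 (ConcRadiiG)
open PlanarSkeletonConc (mem_vspan_edgesIn_iff mem_vspan_edgesIn_of_adj)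

variable {V : Type} [DecidableEq V] {G : SimpleGraph V} [G.LocallyFinite] {φ : V → Site 2}

section Records

variable (P : PCells2) (w₀ : V) {Λ : ConcRadiiG} (hΛ : WFS2 P Λ)

/-! ## §5 `ExitGeom`, `StepsGeom` -/

include hΛ in
/-- **`ExitGeom`** (`locFin` from (lip): a neighbour of `y` inside `E_{w,δ}` pins the macro-vertex `w + δ` within `35 r_i + 1` of `φ y i`).
[cite: KozmaNitzan2024, §4 pp. 26–27] -/
theorem exitGeomSG (hlip : Lip G φ) : ExitGeom G (cellGeomSG G φ P w₀ Λ) where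
  M_subset_Q a v := VWin_mono (P.M_subset_Q v) (let h := hΛ.rM_le_rE_le_rQ a v; h.1.trans h.2)
  Cell_disjoint_Q a a' u x hux := disjoint_VWin (P.Cell_disjoint_Q hux) _ _
  Zone_disjoint_Q a a' u δ x := disjoint_VWin (P.Zone_disjoint_Q u δ x) _ _
  locFin y := by
    set B : Site 2 := fun i => |φ y i| + 35 * P.r i + 1 with hB
    refine (Finset.Icc (-B) B).finite_toSet.subset ?_
    rintro v ⟨a, w, δ, rfl, b, hb, hadj⟩
    change b ∈ VWin G φ w₀ (P.BtwN w δ) (Λ.rB a w δ) ∪ VWin G φ w₀ (P.Q (w + stepVec δ)) (Λ.rQ a (w + stepVec δ)) at hb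
    have hb2 : φ b ∈ P.EwvN w δ := by
      rw [PCells2.EwvN, Finset.mem_union]
      rcases Finset.mem_union.1 hb with h | h
      · exact Or.inl (φ_mem_of_mem_VWin h)
      · exact Or.inr (φ_mem_of_mem_VWin h)
    have hnear : ∀ i, |φ b i - φ y i| ≤ 1 := fun i => by
      rw [abs_sub_comm]; exact hlip hadj i
    rw [Finset.coe_Icc, Set.mem_Icc]
    have key : ∀ i, |(w + stepVec δ) i| ≤ B i := by
      intro i
      have h1 := P.sub_cen_le_of_mem_EwvN hb2 i
      have h2 := hnear i
      rw [abs_le] at h1 h2 ⊢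
      simp only [PCells2.cen_apply] at h1
      simp only [hB]
      have hy := abs_nonneg (φ y i)
      have hy' := le_abs_self (φ y i)
      have hy'' := neg_abs_le (φ y i)
      have hr : (1 : ℤ) ≤ P.r i := by exact_mod_cast P.one_le_r i
      constructor <;> nlinarith
    exact ⟨fun i => (abs_le.1 (key i)).1, fun i => (abs_le.1 (key i)).2⟩

include hΛ in
/-- **`StepsGeom`** (faces ⊆ stubs ⊆ corridor; corridor ⊆ `Q_a ∪ EfarN_{a'}` by the step device; target cube ⊆ far box), under (ι) steps.
[cite: KozmaNitzan2024, §4 pp. 26, 30] -/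
theorem stepsGeomSG (hstep : Steps G φ) : StepsGeom (cellGeomSG G φ P w₀ Λ) (faceDataSG G φ P w₀ Λ) where
  Face_subset_Stub _ _ _ _ := Finset.filter_subset _ _
  Stub_subset_Hfull a v δ j hj := VStair_mono (P.Stub_subset_Hfull v δ (by change j ≤ P.K at hj; exact hj)) fun _ _ => le_rfl
  Hfull_subset a a' v δ ha' := by
    intro y hy
    change y ∈ VStair G φ w₀ (P.Hfull v δ) (prof P Λ a' v δ) at hy
    change y ∈ VWin G φ w₀ (P.Q v) (Λ.rQ a v) ∪ VWin G φ w₀ (P.EfarN v δ) (Λ.rE a' v δ)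
    obtain ⟨hP, hd⟩ := mem_of_mem_VStair hy
    rcases Finset.mem_union.1 (P.Hfull_subset_Q_union_EfarN v δ hP) with h | h
    · exact Finset.mem_union_left _
        (mem_VWin_of_zdAdj hstep hd (hΛ.ρQ1 a a' v δ _ ha' (P.lev_le_of_mem_Q h)) h (P.exists_adj_of_mem_Q v h))
    · exact Finset.mem_union_right _ (mem_VWin_of_zdAdj hstep hd (hΛ.ρE1 a' v δ _) h (P.exists_adj_of_mem_EfarN v δ h))
  M_tgt_subset_Efar a v δ := VWin_mono (P.M_add_stepVec_subset_EfarN v δ) (hΛ.ME a v δ)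

/-! ## §6 `LevelGeom` (staircase levels, narrow boxes, the level shift) and `QSepGeom` -/

omit [DecidableEq V] [G.LocallyFinite] in
/-- Along an edge of `G` the planar level moves by at most one ((lip)). [folklore] -/
theorem lev_le_lev_add_one_of_adj (hlip : Lip G φ) (P : PCells2) {δ : MDir} (v : Site 2) {y z : V} (h : G.Adj y z) :
    P.lev δ v (φ z) ≤ P.lev δ v (φ y) + 1 :=
  P.lev_le_lev_add_one_of_abs_sub_le_one v (by rw [abs_sub_comm]; exact hlip h δ.1)

/-- An inside edge of the corridor staircase starting at planar level `≤ 5r∥ + 10s∥j − 1` is an inside edge of the stub staircase `H^j`: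
both endpoints have planar level `≤ 5r∥ + 10s∥j`. [this work] -/
theorem mem_VStair_Stub_of_adj (hlip : Lip G φ) {P : PCells2} {w₀ : V} {ρ : Site 2 → ℕ} {v : Site 2} {δ : MDir} {j : ℕ} {y z : V}
    (hy : y ∈ stair G φ w₀ (P.Hfull v δ) ρ) (hz : z ∈ stair G φ w₀ (P.Hfull v δ) ρ) (hadj : G.Adj y z)
    (hl : P.lev δ v (φ y) ≤ 5 * (P.r δ.1 : ℤ) + 10 * (P.s δ.1 : ℤ) * j - 1) : y ∈ VStair G φ w₀ (P.Stub v δ j) ρ := by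
  rw [mem_stair] at hy hz
  have hlz : P.lev δ v (φ z) ≤ 5 * P.r δ.1 + 10 * P.s δ.1 * j := by
    have := lev_le_lev_add_one_of_adj hlip P v hadj (δ := δ); omega
  refine (mem_vspan_edgesIn_of_adj ?_ ?_ hadj).1
  · exact mem_stair.2 ⟨P.mem_Stub_of_mem_Hfull hy.1 (by omega), hy.2⟩
  · exact mem_stair.2 ⟨P.mem_Stub_of_mem_Hfull hz.1 hlz, hz.2⟩

/-- An inside edge of a staircase over `H` (or a subset) starting at planar level `≥ 5r∥ + 2` is an inside edge of the window over `EfarN`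
(profile `≤ rE`). [this work] -/
theorem mem_VWin_EfarN_of_adj (hlip : Lip G φ) {P : PCells2} {w₀ : V} {Λ : ConcRadiiG} (hW : WF2 P Λ) {a : ℕ} {v : Site 2} {δ : MDir}
    {Pl : Finset (Site 2)} (hPH : Pl ⊆ P.Hfull v δ) {y z : V} (hy : y ∈ stair G φ w₀ Pl (prof P Λ a v δ))
    (hz : z ∈ stair G φ w₀ Pl (prof P Λ a v δ)) (hadj : G.Adj y z) (hl : 5 * (P.r δ.1 : ℤ) + 2 ≤ P.lev δ v (φ y)) :
    y ∈ VWin G φ w₀ (P.EfarN v δ) (Λ.rE a v δ) := by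
  rw [mem_stair] at hy hz
  have hlz : 5 * (P.r δ.1 : ℤ) + 1 ≤ P.lev δ v (φ z) := by
    have := lev_le_lev_add_one_of_adj hlip P v hadj.symm (δ := δ); omega
  have hyE : φ y ∈ P.EfarN v δ := by
    by_contra hn; have := P.lev_le_of_mem_Hfull_not_EfarN' (hPH hy.1) hn; omega
  have hzE : φ z ∈ P.EfarN v δ := by
    by_contra hn; have := P.lev_le_of_mem_Hfull_not_EfarN' (hPH hz.1) hn; omega
  refine (mem_vspan_edgesIn_of_adj ?_ ?_ hadj).1
  · exact (mem_Win G φ).2 ⟨graphBall_mono G w₀ (hW.ρE a v δ _) hy.2, hyE⟩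
  · exact (mem_Win G φ).2 ⟨graphBall_mono G w₀ (hW.ρE a v δ _) hz.2, hzE⟩

include hΛ in
/-- **`LevelGeom`** over a planar map with the two-unit narrow boxes, the level shift and the STAIRCASE levels (`lev = stairLev δ.1 ∘ planar
level`, `L j = 2j`, `ℓQ = 1`). [cite: KozmaNitzan2024, §4 p. 31 (Step IV)] -/
theorem levelGeomSG (hlip : Lip G φ) : LevelGeom G (cellGeomSG G φ P w₀ Λ) (faceDataSG G φ P w₀ Λ) (levelDataS φ P) where
  adj_le a' v δ y z h := by
    change P.stairLev δ.1 (P.lev δ v (φ z)) ≤ P.stairLev δ.1 (P.lev δ v (φ y)) + 1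
    exact P.stairLev_le_add_one δ.1 (lev_le_lev_add_one_of_adj hlip P v h)
  lev_Q a a' v δ _ y hy := by
    change P.stairLev δ.1 (P.lev δ v (φ y)) ≤ 1
    refine P.stairLev_le_one_of_le δ.1 ?_
    have := P.lev_le_of_mem_Q (δ := δ) (φ_mem_of_mem_VWin hy); omega
  lev_Hfull a' v δ y hy hn := by
    change P.stairLev δ.1 (P.lev δ v (φ y)) ≤ 1
    change y ∉ VWin G φ w₀ (P.EfarN v δ) (Λ.rE a' v δ) at hn
    by_contra hlt
    have h2 := P.base_add_two_le_of_two_le_stairLev δ.1 (show (2 : ℤ) ≤ P.stairLev δ.1 (P.lev δ v (φ y)) by omega)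
    obtain ⟨hyS, z, hz, hadj⟩ := mem_vspan_edgesIn_iff.1 hy
    exact hn (mem_VWin_EfarN_of_adj hlip hΛ.toWF2 subset_rfl hyS hz hadj h2)
  ℓQ_lt j hj := by
    change (1 : ℤ) < 2 * (j : ℤ)
    have : (1 : ℤ) ≤ j := by exact_mod_cast hj
    omega
  mem_Stub a' v δ j _ _ y hy hl := by
    change P.stairLev δ.1 (P.lev δ v (φ y)) ≤ 2 * (j : ℤ) at hl
    obtain ⟨hyS, z, hz, hadj⟩ := mem_vspan_edgesIn_iff.1 hy
    exact mem_VStair_Stub_of_adj hlip hyS hz hadj (P.le_faceRow_of_stairLev_le δ.1 hl)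
  mem_Face a' v δ j _ _ y hy hl := by
    change P.stairLev δ.1 (P.lev δ v (φ y)) = 2 * (j : ℤ) at hl
    have hl' := P.eq_faceRow_of_stairLev_eq δ.1 hl
    obtain ⟨hyS, z, hz, hadj⟩ := mem_vspan_edgesIn_iff.1 hy
    exact Finset.mem_filter.2 ⟨mem_VStair_Stub_of_adj hlip hyS hz hadj hl'.le, hl'⟩
  Face_far a' v δ j hjK t ht := by
    obtain ⟨htS, hl⟩ := Finset.mem_filter.1 ht
    have hs1 : (1 : ℤ) ≤ P.s δ.1 := by exact_mod_cast P.hs δ.1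
    refine ⟨?_, ?_⟩
    · change t ∈ VWin G φ w₀ (P.EfarN v δ) (Λ.rE a' v δ)
      obtain ⟨htS', z, hz, hadj⟩ := mem_vspan_edgesIn_iff.1 htS
      refine mem_VWin_EfarN_of_adj hlip hΛ.toWF2 (P.Stub_subset_Hfull v δ hjK) htS' hz hadj ?_
      rw [hl]; push_cast; nlinarith
    · change 2 * (j : ℤ) + 1 ≤ P.stairLev δ.1 (P.lev δ v (φ t))
      rw [hl, P.stairLev_faceRow δ.1 (j + 1)]; push_cast; omega
  M_far a' v δ t ht := by
    have hl := P.lev_ge_of_mem_M_add (δ := δ) (φ_mem_of_mem_VWin ht)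
    have hrK : (P.r δ.1 : ℤ) = P.K * P.s δ.1 := P.r_eq δ.1
    refine ⟨VWin_mono (P.M_add_stepVec_subset_EfarN v δ) (hΛ.ME a' v δ) ht, ?_⟩
    change 2 * ((P.K : ℕ) : ℤ) + 1 ≤ P.stairLev δ.1 (P.lev δ v (φ t))
    refine P.stairLev_ge_of_face_le δ.1 ?_
    nlinarith
  Btw_sep_Efar a a' w δw du hdu := by
    change KNCells.Sep G (VWin G φ w₀ (P.BtwN w δw) (Λ.rB a w δw)) (VWin G φ w₀ (P.EfarN (w + stepVec δw) du) (Λ.rE a' (w + stepVec δw) du))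
    rw [← P.BtwN_rev' w δw]
    exact sep_VWin_of_sepInf hlip (P.BtwN_sepInf_EfarN (w + stepVec δw) (Ne.symm hdu)) _ _
  Cell_sep_Efar b a' u v δ huv hux := sep_VWin_of_sepInf hlip (P.Cell_sepInf_EfarN huv hux) _ _
  Zone_sep_Efar b a' u δ' v δ huv hux := sep_VWin_of_sepInf hlip (P.Zone_sepInf_EfarN huv hux δ') _ _

/-- **`QSepGeom`** (cells and zones of other macro-vertices against the cube; wide boxes), from (lip). [cite: KozmaNitzan2024, §4 p. 26 ((29))] -/
theorem qSepGeomSG (hlip : Lip G φ) : QSepGeom G (cellGeomSG G φ P w₀ Λ) where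
  Cell_sep_Q _ _ _ _ hux := sep_VWin_of_sepInf hlip (P.Cell_sepInf_Q hux) _ _
  Zone_sep_Q _ _ u δ x _ := sep_VWin_of_sepInf hlip (P.Zone_sepInf_Q u δ x) _ _

end Records

end Skelφ

end Transplant

end Summit.CriticalPhenomena.PercolationContinuityZ3.Theorems

end
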